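import Summits.BirchSwinnertonDyer.BirchSwinnertonDyer.Theses.BiquadraticEisensteinDescent
import Literature.NumberTheory.EllipticCurves.TianYuanZhang2017.GenusPeriodsParity
import Literature.NumberTheory.EllipticCurves.Kriz2020.GoldfeldJ1728Proofs
import Literature.NumberTheory.EllipticCurves.Smith2016.CongruentNumberGenusDeterminantUnconditional
import Literature.NumberTheory.EllipticCurves.Smith2016.CongruentNumberGenusDeterminantRowsTwoThree
import Mathlib.NumberTheory.LegendreSymbol.JacobiSymbol

/-!
# Sketch — crux-ideate seat 2 (g14), `stmt-BirchSwinnertonDyer-21381` `HeegnerTwistCouplingInSupply`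

First-lemma signatures for the crux idea card `three-squares-heegner-pin`
(Legendre–Gauss three-square representations of `2p` PIN an auxiliary prime `ℓ < 2p`,
`ℓ ≡ 5 (mod 8)`, `(ℓ/p) = −1`, Siegel-free; with the partner prime `3` (resp. `5`) this is a
Rédei-robust Smith/Monsky cell, so Tian–Yuan–Zhang parity gives `L(E_{n},1) ≠ 0` for the
Heegner twist and `h(−3ℓ) < p` gives `p ∤ h`).  Planner sketch: nothing here is proved,
nothing is filed as a statement item, no skeleton is registered.
-/

open scoped Classical
open Literature.NumberTheory.EllipticCurves
open Literature.NumberTheory.EllipticCurves.TianYuanZhang2017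

namespace Summit.BirchSwinnertonDyer.BirchSwinnertonDyer.Cruxes.HeegnerTwistCouplingInSupply.ThreeSquaresHeegnerPin

/-- The crux, by name. -/
abbrev Crux : Prop :=
  Summit.BirchSwinnertonDyer.BirchSwinnertonDyer.Theses.BiquadraticEisensteinDescent.HeegnerTwistCouplingInSupply

/-- **Input (classical, Legendre 1798 / Gauss D.A. art. 291–292; not in Mathlib or the tree):**
the three-square theorem in the weak form the line uses (`n ≢ 0 (mod 4)`, `n ≢ 7 (mod 8)`). -/
def LegendreThreeSquares : Prop :=
  ∀ n : ℕ, ¬ 4 ∣ n → n % 8 ≠ 7 → ∃ x y z : ℕ, x ^ 2 + y ^ 2 + z ^ 2 = n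

/-- **First lemma (L1, THE PIN; elementary from `LegendreThreeSquares` at `n = 2p ≡ 6 (mod 8)`).**
For every prime `p ≡ 3 (mod 4)` there is a prime `ℓ < 2p` with `ℓ ≡ 5 (mod 8)` and `(ℓ/p) = −1`
(type `(5,−)`): write `2p = x² + y² + z²` with `z` odd; `a = 2p − z² ≡ 5 (mod 8)` is `x² + y²` with
`x` odd, `y ≡ 2 (mod 4)`, so the primitive part of `a` is a product of primes `≡ 1 (mod 4)` containing an
odd number `≡ 5 (mod 8)`; any such `ℓ` has `z² ≡ 2p (mod ℓ)`, i.e. `(2p/ℓ) = 1`, whence `(ℓ/p) = −1`. -/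
def ThreeSquaresPin : Prop :=
  ∀ p : ℕ, p.Prime → p % 4 = 3 →
    ∃ ℓ : ℕ, ℓ.Prime ∧ ℓ < 2 * p ∧ ℓ % 8 = 5 ∧ jacobiSym (ℓ : ℤ) p = -1

/-- The elementary implication the first prover target would be (M-sized in Lean). -/
def ThreeSquaresPin_of_Legendre : Prop := LegendreThreeSquares → ThreeSquaresPin

/-- **Second pin (L1′, from the same theorem at `n = 2p`, via `p = u² + 2v² + w²`,
`u = (x+y)/2, w = (x−y)/2, v = z/2`):** for every prime `p ≡ 3 (mod 4)`, `p ≠ 11`... stated with the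
harmless bound `ℓ < p`: a prime `ℓ ≡ 3 (mod 8)` with `(ℓ/p) = −1` (type `(3,−)`), from a prime factor of
`u² + 2v² = p − w² ≡ 3 (mod 8)`, `w ≡ 2 (mod 4)` resp. `w ≡ 0 (mod 4)`, `w ≠ 0`
(non-degenerate representations exist as soon as `h(−8p) > 2`). -/
def TernaryPinThreeMinus : Prop :=
  ∀ p : ℕ, p.Prime → p % 4 = 3 → 11 < p →
    ∃ ℓ : ℕ, ℓ.Prime ∧ ℓ < p ∧ ℓ % 8 = 3 ∧ jacobiSym (ℓ : ℤ) p = -1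

/-- **L2 (Rédei-robust cell `B = {(3,−),(5,+)}` for Monsky's EVEN matrix; finite `𝔽₂` identity,
checked for both values of the free symbol `(ℓ₁/ℓ₂)` by `compute/monsky_game.py`).**
Cell `A = {(3,+),(5,−)}` is g5's `RobustPairSmithDetOne` (row 1) and its row-2 analogue. -/
def RobustCellBRowTwo : Prop :=
  ∀ (q : Fin 3 → ℕ), (∀ i, (q i).Prime) → q 0 % 4 = 3 → q 1 % 8 = 3 → q 2 % 8 = 5 →
    jacobiSym (q 1 : ℤ) (q 0) = -1 → jacobiSym (q 2 : ℤ) (q 0) = 1 →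
    (HeathBrown1994.monskyMatrixEven q).det = 1

/-- Row-2 analogue of g5's robust cell `A = {(3,+),(5,−)}`. -/
def RobustCellARowTwo : Prop :=
  ∀ (q : Fin 3 → ℕ), (∀ i, (q i).Prime) → q 0 % 4 = 3 → q 1 % 8 = 3 → q 2 % 8 = 5 →
    jacobiSym (q 1 : ℤ) (q 0) = 1 → jacobiSym (q 2 : ℤ) (q 0) = -1 →
    (HeathBrown1994.monskyMatrixEven q).det = 1

/-- **Target on the corner `W = E_{2p}`, `p ≡ 11 (mod 12)`** — literally the conclusion of
`HeegnerTwistCouplingInSupply` for these `W`, with the EXPLICIT witness `K′ = ℚ(√−3ℓ)`, `ℓ` the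
three-squares pin: `2, p` split (`−3ℓ ≡ 1 (mod 8)`, `(−3ℓ/p) = +1`), `W^{(−3ℓ)} = E_{6pℓ}`
(`quadraticTwist_congruentNumberCurve`), `det M_even(p,3,ℓ) = 1` (cell `A`, since `(3/p) = +1`) so
`L(E_{6pℓ},1) ≠ 0` by `smith_thm22_rowTwo` + TYZ Thm 1.1, and `h(−3ℓ) ≤ √(6p)·log(6p)/π < p`. -/
def CruxOnE2pCornerMod12 : Prop :=
  ∀ (p : ℕ) [Fact p.Prime] [(congruentNumberCurve (2 * p)).IsElliptic]
    [(congruentNumberCurve (2 * p)).IsGloballyMinimal]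
    [NeZero ((congruentNumberCurve (2 * p)).conductorNorm ℤ)],
    p % 12 = 11 →
    ∃ (ℓ : ℕ) (K : Type) (_ : Field K) (_ : NumberField K),
      ℓ.Prime ∧ ℓ < 2 * p ∧ ℓ % 8 = 5 ∧ jacobiSym (ℓ : ℤ) p = -1 ∧
      IsImaginaryQuadratic K ∧ NumberField.discr K = -((3 * ℓ : ℕ) : ℤ) ∧
      SatisfiesHeegnerHypothesis ((congruentNumberCurve (2 * p)).conductorNorm ℤ) K ∧
      ((congruentNumberCurve (2 * p)).quadraticTwist (NumberField.discr K : ℚ)).entireLFunction 1 ≠ 0 ∧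
      NumberField.classNumber K < p

/-- **Target on the corner `W = E_p`, `p ≡ 23 (mod 24)`** (row 1, cell `A` with partner `3`). -/
def CruxOnEpCornerMod24 : Prop :=
  ∀ (p : ℕ) [Fact p.Prime] [(congruentNumberCurve p).IsElliptic]
    [(congruentNumberCurve p).IsGloballyMinimal] [NeZero ((congruentNumberCurve p).conductorNorm ℤ)],
    p % 24 = 23 →
    ∃ (ℓ : ℕ) (K : Type) (_ : Field K) (_ : NumberField K),
      ℓ.Prime ∧ ℓ < 2 * p ∧ ℓ % 8 = 5 ∧ jacobiSym (ℓ : ℤ) p = -1 ∧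
      IsImaginaryQuadratic K ∧ NumberField.discr K = -((3 * ℓ : ℕ) : ℤ) ∧
      SatisfiesHeegnerHypothesis ((congruentNumberCurve p).conductorNorm ℤ) K ∧
      ((congruentNumberCurve p).quadraticTwist (NumberField.discr K : ℚ)).entireLFunction 1 ≠ 0 ∧
      NumberField.classNumber K < p

/-- **Target on the corner `W = E_{2p}`, `p ≡ ±1 (mod 5)`, `p ≡ 3 (mod 4)`** (cell `B` with partner
`5`, `ℓ′` the `(3,−)` pin, `K′ = ℚ(√−5ℓ′)`). -/
def CruxOnE2pCornerMod5 : Prop :=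
  ∀ (p : ℕ) [Fact p.Prime] [(congruentNumberCurve (2 * p)).IsElliptic]
    [(congruentNumberCurve (2 * p)).IsGloballyMinimal]
    [NeZero ((congruentNumberCurve (2 * p)).conductorNorm ℤ)],
    p % 4 = 3 → (p % 5 = 1 ∨ p % 5 = 4) → 11 < p →
    ∃ (ℓ : ℕ) (K : Type) (_ : Field K) (_ : NumberField K),
      ℓ.Prime ∧ ℓ < p ∧ ℓ % 8 = 3 ∧ jacobiSym (ℓ : ℤ) p = -1 ∧
      IsImaginaryQuadratic K ∧ NumberField.discr K = -((5 * ℓ : ℕ) : ℤ) ∧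
      SatisfiesHeegnerHypothesis ((congruentNumberCurve (2 * p)).conductorNorm ℤ) K ∧
      ((congruentNumberCurve (2 * p)).quadraticTwist (NumberField.discr K : ℚ)).entireLFunction 1 ≠ 0 ∧
      NumberField.classNumber K < p

/-- Shape check: the twist of `E_{2p}` by `d = −3ℓ` is the congruent curve `E_{2p·3ℓ}` (tree lemma). -/
example (p ℓ : ℕ) :
    (congruentNumberCurve (2 * p)).quadraticTwist ((-((3 * ℓ : ℕ) : ℤ) : ℤ) : ℚ)
      = congruentNumberCurve (2 * p * (3 * ℓ)) := by
  rw [quadraticTwist_congruentNumberCurve, Int.natAbs_neg, Int.natAbs_natCast]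

/-- Sanity instance of the pin at `p = 23`: `46 = 1 + 9 + 36`, `a = 46 − 1 = 45 = 9·5`, `ℓ = 5`,
`(5/23) = −1`. -/
example : jacobiSym 5 23 = -1 := by norm_num [jacobiSym]
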